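import Mathlib
import Literature.NumberTheory.LFunctions.Zhang2022.AppendixBTailB3Weights
import HarnessLib

/-!
# Zhang (2022), Appendix B, proof of (B.3): the averaged sharp weight and the Gaussian transition

Topic `Literature/NumberTheory/LFunctions/Zhang2022` (Landau–Siegel audit tree; verdict-neutral).
Y. Zhang, *Discrete mean estimates and the Landau–Siegel zero*, arXiv:2211.02515v1 (2022)
[Zhang2022LandauSiegel] — **an unrefereed manuscript under adjudication**; nothing here asserts or denies
its Theorems 1–2. Appendix B p. 108 (tex L5322, DAG `Z22:§B.u013`): "By (4.2) and (4.3), the left side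
of (B.3) is equal to `Σ_l ϱ_j(l)/l (P₁/(l₁l))^{β₆} (1/0.504)∫_{0.5}^{0.504} {g(P^z/(l₁l)) − g(P^{0.5}/(l₁l))} dz
+ O(α₁)`". Companion of `AppendixBTailB3Weights` (the pointwise transition bounds): this file evaluates
the `z`-averaged SHARP weight `mainW(P, y) := ∫_{0.5}^{0.504} 1[log y/log P < z]dz − 0.004·1[y < P^{1/2}]`
below the cut (`= 0`), above it (`(1/0.504)·mainW = (1 − log y/(0.504 log P))₊`, the amplitude of `ϰ₁`)
and beyond `P` (`= 0`), and bounds the transition `∫(g(P^z/y) − g(P^{0.5}/y))dz − mainW` off the window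
`|log P/2 − log y| ≥ 1` (`≤ ½√(π/Λ)/log P + 0.002e^{−Λ}`) and beyond `P` (`≤ 0.004y⁻²`). The source-level
statement `Z22:§B.u013` is assembled in `AppendixBTailB3U013`. No claim about Lemma 15.1, Theorems 1–2
of the source or about Landau–Siegel zeros is made.
-/

noncomputable section

open Complex Real Finset MeasureTheory Set

namespace Literature.NumberTheory.LFunctions.Zhang2022.AppendixBVarrho

open Literature.NumberTheory.LFunctions.Zhang2022 GaussWeight

/-! ## The main term of the weight: below, above and beyond the cut

In the statements below the `z`-averaged sharp weight
`mainW(P, y) := ∫_{0.5}^{0.504} 1[log y/log P < z]dz − 0.004·1[y < P^{1/2}]` is written out in full. -/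

/-- Below the cut (`0 < y < P^{1/2}`, `P > 1`) the averaged sharp weight vanishes.
[cite: Zhang2022LandauSiegel, App. B p.108 (proof of (B.3))] -/
theorem mainW_eq_zero_of_lt {P y : ℝ} (hP : 1 < P) (hy : 0 < y) (hyP : y < P ^ (0.5 : ℝ)) :
    ((∫ z in (0.5 : ℝ)..0.504, (Ioi (Real.log y / Real.log P)).indicator (fun _ => (1 : ℝ)) z) -
        0.004 * (if y < P ^ (0.5 : ℝ) then 1 else 0)) = 0 := by
  have hP0 : 0 < P := by linarith
  have hlogP : 0 < Real.log P := Real.log_pos hP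
  have hu : Real.log y / Real.log P < 0.5 := by
    rw [div_lt_iff₀ hlogP]
    have := Real.log_lt_log hy hyP
    rwa [Real.log_rpow hP0] at this
  rw [integral_indicator_eq, if_pos hyP, max_eq_left hu.le]
  norm_num

/-- Above the cut (`y > P^{1/2}`, `P > 1`): `(1/0.504)·mainW = (1 − log y/(0.504 log P))₊`.
[cite: Zhang2022LandauSiegel, App. B p.108 (proof of (B.3))] -/
theorem mainW_eq_of_gt {P y : ℝ} (hP : 1 < P) (hyP : P ^ (0.5 : ℝ) < y) :
    (1 / 0.504) * ((∫ z in (0.5 : ℝ)..0.504, (Ioi (Real.log y / Real.log P)).indicator (fun _ => (1 : ℝ)) z) -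
        0.004 * (if y < P ^ (0.5 : ℝ) then 1 else 0)) =
      max (1 - Real.log y / (0.504 * Real.log P)) 0 := by
  have hP0 : 0 < P := by linarith
  have hlogP : 0 < Real.log P := Real.log_pos hP
  have hy : 0 < y := lt_trans (Real.rpow_pos_of_pos hP0 _) hyP
  have hu : 0.5 < Real.log y / Real.log P := by
    rw [lt_div_iff₀ hlogP]
    have := Real.log_lt_log (Real.rpow_pos_of_pos hP0 _) hyP
    rwa [Real.log_rpow hP0] at this
  rw [integral_indicator_eq, if_neg (not_lt.mpr hyP.le), max_eq_right hu.le, mul_zero, sub_zero]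
  rcases le_or_gt (Real.log y / Real.log P) 0.504 with h | h
  · rw [max_eq_left (by linarith), max_eq_left]
    · field_simp
    · rw [sub_nonneg, div_le_one (by positivity)]
      calc Real.log y = Real.log y / Real.log P * Real.log P := by field_simp
        _ ≤ 0.504 * Real.log P := mul_le_mul_of_nonneg_right h hlogP.le
  · rw [max_eq_right (by linarith), max_eq_right, mul_zero]
    rw [sub_nonpos, one_le_div (by positivity)]
    calc 0.504 * Real.log P ≤ Real.log y / Real.log P * Real.log P :=
          mul_le_mul_of_nonneg_right h.le hlogP.le
      _ = Real.log y := by field_simp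

/-! ## The transition error off the window and beyond `P` -/

/-- Off the window `|log P/2 − log y| ≥ 1` (`Λ > 0`, `P > 1`, `y > 0`):
`|∫_{0.5}^{0.504}(g(P^z/y) − g(P^{0.5}/y))dz − mainW| ≤ ½√(π/Λ)/log P + 0.002e^{−Λ}`.
[cite: Zhang2022LandauSiegel, App. B p.108 (proof of (B.3)); §4 (4.2)–(4.3)] -/
theorem abs_transition_sub_mainW_le_off {Λ P y : ℝ} (hΛ : 0 < Λ) (hP : 1 < P) (hy : 0 < y)
    (hfar : 1 ≤ |0.5 * Real.log P - Real.log y|) :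
    |(∫ z in (0.5 : ℝ)..0.504, (gWeight Λ (P ^ z / y) - gWeight Λ (P ^ (0.5 : ℝ) / y))) -
      ((∫ z in (0.5 : ℝ)..0.504, (Ioi (Real.log y / Real.log P)).indicator (fun _ => (1 : ℝ)) z) -
        0.004 * (if y < P ^ (0.5 : ℝ) then 1 else 0))| ≤
      (1 / 2) * Real.sqrt (π / Λ) / Real.log P + 0.002 * rexp (-Λ) := by
  have hlogP : 0 < Real.log P := Real.log_pos hP
  have h1 := abs_weight_transition_le hΛ hP hy
  have h2 := integral_gauss_transition_le hΛ hlogP (Real.log y)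
  have h3 : (1 / 2) * rexp (-Λ * (0.5 * Real.log P - Real.log y) ^ 2) ≤ (1 / 2) * rexp (-Λ) := by
    refine mul_le_mul_of_nonneg_left (Real.exp_le_exp.mpr ?_) (by norm_num)
    have hsq : 1 ≤ (0.5 * Real.log P - Real.log y) ^ 2 := by
      have := sq_abs (0.5 * Real.log P - Real.log y)
      nlinarith [abs_nonneg (0.5 * Real.log P - Real.log y)]
    nlinarith
  calc _ ≤ (∫ z in (0.5 : ℝ)..0.504, (1 / 2) * rexp (-Λ * (z * Real.log P - Real.log y) ^ 2)) +
        0.004 * ((1 / 2) * rexp (-Λ * (0.5 * Real.log P - Real.log y) ^ 2)) := h1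
    _ ≤ (1 / 2) * Real.sqrt (π / Λ) / Real.log P + 0.004 * ((1 / 2) * rexp (-Λ)) := by gcongr
    _ = _ := by ring

/-- Beyond `P` (`Λ ≥ 9`, `log P ≥ 1`, `y ≥ P`): the transition error is `≤ 0.004·y⁻²`.
[cite: Zhang2022LandauSiegel, App. B p.108 (proof of (B.3)); §4 (4.2)–(4.3)] -/
theorem abs_transition_sub_mainW_le_far {Λ P y : ℝ} (hΛ : 9 ≤ Λ) (hP : 1 ≤ Real.log P) (hP1 : 1 < P)
    (hy : P ≤ y) :
    |(∫ z in (0.5 : ℝ)..0.504, (gWeight Λ (P ^ z / y) - gWeight Λ (P ^ (0.5 : ℝ) / y))) -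
      ((∫ z in (0.5 : ℝ)..0.504, (Ioi (Real.log y / Real.log P)).indicator (fun _ => (1 : ℝ)) z) -
        0.004 * (if y < P ^ (0.5 : ℝ) then 1 else 0))| ≤
      0.004 * y ^ (-2 : ℝ) := by
  have hΛ0 : 0 < Λ := by linarith
  have hP0 : 0 < P := by linarith
  have hy0 : 0 < y := lt_of_lt_of_le hP0 hy
  have hlogy : Real.log P ≤ Real.log y := Real.log_le_log hP0 hy
  have h1 := abs_weight_transition_le hΛ0 hP1 hy0
  have hpt : ∀ z : ℝ, z ≤ 0.504 →
      (1 / 2) * rexp (-Λ * (z * Real.log P - Real.log y) ^ 2) ≤ (1 / 2) * y ^ (-2 : ℝ) :=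
    fun z hz => gauss_transition_decay hΛ hP hy0 hlogy hz
  have hint : (∫ z in (0.5 : ℝ)..0.504, (1 / 2) * rexp (-Λ * (z * Real.log P - Real.log y) ^ 2)) ≤
      0.004 * ((1 / 2) * y ^ (-2 : ℝ)) := by
    have hle : (0.5 : ℝ) ≤ 0.504 := by norm_num
    have hcont : Continuous fun z : ℝ => (1 / 2) * rexp (-Λ * (z * Real.log P - Real.log y) ^ 2) := by
      fun_prop
    have := intervalIntegral.integral_mono_on (μ := volume) hle (hcont.intervalIntegrable _ _)
      intervalIntegrable_const (fun z hz => hpt z hz.2)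
    rw [intervalIntegral.integral_const, smul_eq_mul] at this
    calc _ ≤ (0.504 - 0.5) * ((1 / 2) * y ^ (-2 : ℝ)) := this
      _ = _ := by norm_num
  have h05 := hpt 0.5 (by norm_num)
  calc _ ≤ (∫ z in (0.5 : ℝ)..0.504, (1 / 2) * rexp (-Λ * (z * Real.log P - Real.log y) ^ 2)) +
        0.004 * ((1 / 2) * rexp (-Λ * (0.5 * Real.log P - Real.log y) ^ 2)) := h1
    _ ≤ 0.004 * ((1 / 2) * y ^ (-2 : ℝ)) + 0.004 * ((1 / 2) * y ^ (-2 : ℝ)) := by gcongr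
    _ = _ := by ring

/-- Beyond `P` the averaged sharp weight vanishes (`y ≥ P > 1`).
[cite: Zhang2022LandauSiegel, App. B p.108 (proof of (B.3))] -/
theorem mainW_eq_zero_of_ge {P y : ℝ} (hP : 1 < P) (hy : P ≤ y) :
    ((∫ z in (0.5 : ℝ)..0.504, (Ioi (Real.log y / Real.log P)).indicator (fun _ => (1 : ℝ)) z) -
        0.004 * (if y < P ^ (0.5 : ℝ) then 1 else 0)) = 0 := by
  have hP0 : 0 < P := by linarith
  have hlogP : 0 < Real.log P := Real.log_pos hP
  have hy0 : 0 < y := lt_of_lt_of_le hP0 hy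
  have hu : 1 ≤ Real.log y / Real.log P := by
    rw [le_div_iff₀ hlogP, one_mul]; exact Real.log_le_log hP0 hy
  have hhalf : P ^ (0.5 : ℝ) ≤ y := by
    calc P ^ (0.5 : ℝ) ≤ P ^ (1 : ℝ) := Real.rpow_le_rpow_of_exponent_le hP.le (by norm_num)
      _ = P := Real.rpow_one P
      _ ≤ y := hy
  rw [integral_indicator_eq, if_neg (not_lt.mpr hhalf), mul_zero, sub_zero,
    max_eq_right (show (0.5 : ℝ) ≤ Real.log y / Real.log P by linarith), max_eq_right (by linarith)]

/-- The `z`-integral of the weight difference is at most `0.004` in absolute value (`0 < g < 1`).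
[cite: Zhang2022LandauSiegel, §4 (4.1)] -/
theorem abs_transition_le {Λ : ℝ} (hΛ : 0 < Λ) (a b : ℝ → ℝ) :
    |∫ z in (0.5 : ℝ)..0.504, (gWeight Λ (a z) - gWeight Λ (b z))| ≤ 0.004 := by
  have h := intervalIntegral.norm_integral_le_of_norm_le_const (a := (0.5 : ℝ)) (b := 0.504) (C := 1)
    (f := fun z => gWeight Λ (a z) - gWeight Λ (b z)) (fun z _ => by
      rw [Real.norm_eq_abs, abs_le]
      have h1 := gWeight_pos hΛ (a z); have h2 := gWeight_lt_one hΛ (a z)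
      have h3 := gWeight_pos hΛ (b z); have h4 := gWeight_lt_one hΛ (b z)
      constructor <;> linarith)
  rw [Real.norm_eq_abs] at h
  calc _ ≤ 1 * |(0.504 : ℝ) - 0.5| := h
    _ = 0.004 := by norm_num


end Literature.NumberTheory.LFunctions.Zhang2022.AppendixBVarrho
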